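import Summits.KontsevichZagierPeriods.KontsevichZagierPeriods.Theorems.LinRedNormalFormArrangementNormalFormStubRebaseSimplePosOneFibreSwapSheared
import Summits.KontsevichZagierPeriods.KontsevichZagierPeriods.Theorems.LinRedNormalFormArrangementNormalFormStubRebaseSimplePosOneFibreOrderGood

/-!
# Stub `stub_rebaseSimplePosOne` (crux `ArrangementNormalForm`, line `janus-bands`, v6.2) —
part `SwapBand`: a band through the coordinate swap `y ↔ t`

`RebasePos.good_swapBand`: a one-fibre band `{rows, u < t < v}` with letter `0`, transverse
non-parallel bounds of the same sign in `y`, base factor `g(x')/(y − ℓ₂(x'))`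
(`n₁ = 0`, `n₂ = 1`), on whose domain the `x'`-forms `κ₀`, `φℓ := (v − u)(x', ℓ₂(x'))`
satisfy `|κ₀| < |φℓ|` and `u(x', ℓ₂(x')) = κ₀ + A' φℓ` (in the application `κ₀ = κ`, the apex
level, `A' = A`: `φℓ = 0` says that the pole `y = ℓ₂` passes through the apex), is congruent
to the subgroup generated by `GG B 2 1` as soon as — for the SWAPPED parameters (base pole `0`)
— parallel bands and DOUBLE-CORNER bands (corner `κ = u = v = 0` in the closure of the open base
cell, ON the pole hyperplane) are. Proof: swap `y ↔ t` (`RebasePos.swapBandYT`, rule 2),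
total-order refinement of the swapped order cell (`RebasePos.orderCells_good`, rule 1a); a cell
with a `Y`-free bound is a product (`RebasePos.good_product`), equal transverse bounds are
empty, and the two transverse cells `(invF u, invF v)`, `(invF v, invF u)` are
`RebasePos.good_swapPiece`: shear the letter `ℓ₂` to `0` (rule 2) and `RebasePos.good_shearedPiece`
with the key property `RebasePos.yval_eq_zero_of_corner` — at a corner of the sheared cell both
bounds vanish, i.e. `u(x', ℓ₂) = Y = v(x', ℓ₂)`, so `φℓ = 0`, the region invariant gives
`κ₀ = 0`, and `Y = κ₀ + A' φℓ = 0`: the corner lies on the swapped pole hyperplane `Y = 0`.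
Registered: `rebaseSimplePos_yvalEqZeroOfCorner`.

References: M. Kontsevich, D. Zagier, *Periods* (2001), §1.2, rules (1a), (2).
-/

noncomputable section

open Set MeasureTheory MvPolynomial
open Literature.NumberTheory.Transcendental Literature.ModelTheory.ExponentialFields

namespace Summit.KontsevichZagierPeriods.ArrangementNormalForm.JanusBands

namespace RebasePos

open SeparatePos

section SwapBand

variable {B m m' : ℕ}

/-- **The key computation at a corner of a swapped transverse cell.** If both transverse players
take the value `ℓ₂(x')` at `z` (after the shear: both bounds vanish), then
`Y = u(x', ℓ₂) = v(x', ℓ₂)`, so `φℓ(z) = 0`; with `|κ₀| ≤ |φℓ|` at `z` and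
`u(x', ℓ₂) = κ₀ + A' φℓ` the coordinate `Y` of `z` vanishes. -/
theorem yval_eq_zero_of_corner (u v : (Fin (B + 1) → ℚ) × ℚ) (κ₀ ℓ₂ : (Fin B → ℚ) × ℚ) (A' : ℚ)
    (hu : u.1 (Fin.last B) ≠ 0) (hv : v.1 (Fin.last B) ≠ 0)
    (huℓ : restr B u + u.1 (Fin.last B) • ℓ₂ =
      κ₀ + A' • ((restr B v - restr B u) + (v.1 (Fin.last B) - u.1 (Fin.last B)) • ℓ₂))
    (z : Fin (B + 1 + 1) → ℝ)
    (hreg : |affB B 1 κ₀ z| ≤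
      |affB B 1 ((restr B v - restr B u) + (v.1 (Fin.last B) - u.1 (Fin.last B)) • ℓ₂) z|)
    (h1 : affF B 1 (((Fin.snoc (fun i : Fin B => -u.1 (Fin.castSucc i) / u.1 (Fin.last B)) (1 / u.1 (Fin.last B)) : Fin (B + 1) → ℚ), -u.2 / u.1 (Fin.last B)) : (Fin (B + 1) → ℚ) × ℚ) z = affB B 1 ℓ₂ z) (h2 : affF B 1 (((Fin.snoc (fun i : Fin B => -v.1 (Fin.castSucc i) / v.1 (Fin.last B)) (1 / v.1 (Fin.last B)) : Fin (B + 1) → ℚ), -v.2 / v.1 (Fin.last B)) : (Fin (B + 1) → ℚ) × ℚ) z = affB B 1 ℓ₂ z) :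
    z (Fin.castAdd 1 (Fin.last B)) = 0 := by
  have hu' : (u.1 (Fin.last B) : ℝ) ≠ 0 := by exact_mod_cast hu
  have hv' : (v.1 (Fin.last B) : ℝ) ≠ 0 := by exact_mod_cast hv
  rw [affF_invF u hu, div_eq_iff hu'] at h1
  rw [affF_invF v hv, div_eq_iff hv'] at h2
  have hφ : affB B 1 ((restr B v - restr B u) + (v.1 (Fin.last B) - u.1 (Fin.last B)) • ℓ₂) z = 0 := by
    rw [affB_addYT, affB_sub, affB_smul']
    push_cast
    linarith
  have hκ : affB B 1 κ₀ z = 0 := by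
    rw [hφ, abs_zero] at hreg
    exact abs_nonpos_iff.mp hreg
  have hU := congrArg (fun d => affB B 1 d z) huℓ
  simp only [affB_addYT, affB_smul', hκ, hφ, mul_zero, add_zero] at hU
  linarith

variable (L : Fin m → (Fin B → ℚ) × ℚ) (e : Fin m → ℕ) (ℓ₁ ℓ₂ : (Fin B → ℚ) × ℚ)

/-- **A transverse cell of the swapped band.** A cell `{rows, invF c₁ < T < invF c₂}`,
`{c₁, c₂} = {u, v}`, of the swapped band (fibre letter `ℓ₂` lifted, base factor `g(x')/Y`) with
the region invariant is good from parallel and double-corner bands (swapped parameters): shear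
the letter to `0` (rule 2) and `good_shearedPiece` with `yval_eq_zero_of_corner`. -/
theorem good_swapPiece {m'' : ℕ} (s' : KZ.IntegralRep (B + 1 + 1)) (M' : Fin m'' → (Fin (B + 1) → ℚ) × ℚ)
    (p : MvPolynomial (Fin B) ℚ) (u v c₁ c₂ : (Fin (B + 1) → ℚ) × ℚ) (κ₀ : (Fin B → ℚ) × ℚ) (A' : ℚ)
    (hbd : Bornology.IsBounded s'.domain)
    (hdom : s'.domain = gDom B 1 m'' M' (fun _ => Sum.inr (((Fin.snoc (fun i : Fin B => -c₁.1 (Fin.castSucc i) / c₁.1 (Fin.last B)) (1 / c₁.1 (Fin.last B)) : Fin (B + 1) → ℚ), -c₁.2 / c₁.1 (Fin.last B)) : (Fin (B + 1) → ℚ) × ℚ)) (fun _ => Sum.inr (((Fin.snoc (fun i : Fin B => -c₂.1 (Fin.castSucc i) / c₂.1 (Fin.last B)) (1 / c₂.1 (Fin.last B)) : Fin (B + 1) → ℚ), -c₂.2 / c₂.1 (Fin.last B)) : (Fin (B + 1) → ℚ) × ℚ)))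
    (hint : EqOn s'.integrand (glit B 1 p L e ℓ₁ 0 0 1 (fun _ => some (((Fin.snoc (ℓ₂).1 0 : Fin (B + 1) → ℚ), (ℓ₂).2) : (Fin (B + 1) → ℚ) × ℚ))) s'.domain)
    (hc : (c₁ = u ∧ c₂ = v) ∨ (c₁ = v ∧ c₂ = u))
    (hu : u.1 (Fin.last B) ≠ 0) (hv : v.1 (Fin.last B) ≠ 0) (hne : u.1 (Fin.last B) ≠ v.1 (Fin.last B))
    (huℓ : restr B u + u.1 (Fin.last B) • ℓ₂ =
      κ₀ + A' • ((restr B v - restr B u) + (v.1 (Fin.last B) - u.1 (Fin.last B)) • ℓ₂))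
    (hZ : ∀ w ∈ s'.domain, |affB B 1 κ₀ w| <
      |affB B 1 ((restr B v - restr B u) + (v.1 (Fin.last B) - u.1 (Fin.last B)) • ℓ₂) w|)
    (Hpar : ∀ (m' : ℕ) (s : KZ.IntegralRep (B + 1 + 1)) (M : Fin m' → (Fin (B + 1) → ℚ) × ℚ)
      (p : MvPolynomial (Fin B) ℚ) (u v : (Fin (B + 1) → ℚ) × ℚ), Bornology.IsBounded s.domain →
      s.domain = gDom B 1 m' M (fun _ => Sum.inr u) (fun _ => Sum.inr v) →
      EqOn s.integrand (glit B 1 p L e ℓ₁ 0 0 1 (fun _ => some 0)) s.domain →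
      u.1 (Fin.last B) ≠ 0 → u.1 (Fin.last B) = v.1 (Fin.last B) →
      (∀ z : Fin (B + 1 + 1) → ℝ, (∀ j, 0 < affF B 1 (M j) z) → 0 < affF B 1 u z ∧ affF B 1 u z < affF B 1 v z) →
      ∃ c ∈ AddSubgroup.closure (GGset B 2 1), KZ.of s - c ∈ KZ.relations)
    (Hdthick : ∀ (m' : ℕ) (s : KZ.IntegralRep (B + 1 + 1)) (M : Fin m' → (Fin (B + 1) → ℚ) × ℚ)
      (p : MvPolynomial (Fin B) ℚ) (u v κ : (Fin (B + 1) → ℚ) × ℚ) (A : ℚ), Bornology.IsBounded s.domain →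
      s.domain = gDom B 1 m' M (fun _ => Sum.inr u) (fun _ => Sum.inr v) →
      EqOn s.integrand (glit B 1 p L e ℓ₁ 0 0 1 (fun _ => some 0)) s.domain →
      κ.1 (Fin.last B) = 0 → u - κ = A • (v - u) → 0 < A →
      (∀ z : Fin (B + 1 + 1) → ℝ, (∀ j, 0 < affF B 1 (M j) z) →
        affF B 1 κ z < 0 ∧ 0 < affF B 1 u z ∧ affF B 1 u z < affF B 1 v z) →
      (∃ z ∈ closure {z : Fin (B + 1 + 1) → ℝ | ∀ j, 0 < affF B 1 (M j) z},
        affF B 1 κ z = 0 ∧ affF B 1 u z = 0 ∧ affF B 1 v z = 0 ∧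
        z (Fin.castAdd 1 (Fin.last B)) = affB B 1 (0 : (Fin B → ℚ) × ℚ) z) →
      ∃ c ∈ AddSubgroup.closure (GGset B 2 1), KZ.of s - c ∈ KZ.relations)
    (Hdfar : ∀ (m' : ℕ) (s : KZ.IntegralRep (B + 1 + 1)) (M : Fin m' → (Fin (B + 1) → ℚ) × ℚ)
      (p : MvPolynomial (Fin B) ℚ) (u v κ : (Fin (B + 1) → ℚ) × ℚ) (A : ℚ), Bornology.IsBounded s.domain →
      s.domain = gDom B 1 m' M (fun _ => Sum.inr u) (fun _ => Sum.inr v) →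
      EqOn s.integrand (glit B 1 p L e ℓ₁ 0 0 1 (fun _ => some 0)) s.domain →
      κ.1 (Fin.last B) = 0 → u - κ = A • (v - u) → 0 < A →
      (∀ z : Fin (B + 1 + 1) → ℝ, (∀ j, 0 < affF B 1 (M j) z) →
        0 < affF B 1 κ z ∧ affF B 1 u z < affF B 1 v z ∧ 2 * affF B 1 κ z ≤ affF B 1 v z) →
      (∃ z ∈ closure {z : Fin (B + 1 + 1) → ℝ | ∀ j, 0 < affF B 1 (M j) z},
        affF B 1 κ z = 0 ∧ affF B 1 u z = 0 ∧ affF B 1 v z = 0 ∧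
        z (Fin.castAdd 1 (Fin.last B)) = affB B 1 (0 : (Fin B → ℚ) × ℚ) z) →
      ∃ c ∈ AddSubgroup.closure (GGset B 2 1), KZ.of s - c ∈ KZ.relations) :
    ∃ c ∈ AddSubgroup.closure (GGset B 2 1), KZ.of s' - c ∈ KZ.relations := by
  have hc₁ : c₁.1 (Fin.last B) ≠ 0 := by rcases hc with ⟨rfl, -⟩ | ⟨rfl, -⟩ <;> assumption
  have hc₂ : c₂.1 (Fin.last B) ≠ 0 := by rcases hc with ⟨-, rfl⟩ | ⟨-, rfl⟩ <;> assumption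
  have hc12 : c₁.1 (Fin.last B) ≠ c₂.1 (Fin.last B) := by
    rcases hc with ⟨rfl, rfl⟩ | ⟨rfl, rfl⟩
    · exact hne
    · exact hne.symm
  -- shear the letter `ℓ₂` to `0`
  set α : ℚ := ((((Fin.snoc (ℓ₂).1 0 : Fin (B + 1) → ℚ), (ℓ₂).2) : (Fin (B + 1) → ℚ) × ℚ)).1 (Fin.last B) with hα
  set δ : (Fin B → ℚ) × ℚ := restr B (((Fin.snoc (ℓ₂).1 0 : Fin (B + 1) → ℚ), (ℓ₂).2) : (Fin (B + 1) → ℚ) × ℚ) with hδ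
  have hα0 : α = 0 := by simp [hα]
  have hδ0 : δ = ℓ₂ := by rw [hδ]; exact restr_liftF ℓ₂
  obtain ⟨s₁, hΨ₁, hbd₁, hdom₁, hint₁, hrel₁⟩ := pull (fun _ : Fin 1 => (1 : ℚ)) (fun _ => α)
    (fun _ => δ) s' M' L e p ℓ₁ 0 0 1 (fun _ => some (((Fin.snoc (ℓ₂).1 0 : Fin (B + 1) → ℚ), (ℓ₂).2) : (Fin (B + 1) → ℚ) × ℚ)) (fun _ => Sum.inr (((Fin.snoc (fun i : Fin B => -c₁.1 (Fin.castSucc i) / c₁.1 (Fin.last B)) (1 / c₁.1 (Fin.last B)) : Fin (B + 1) → ℚ), -c₁.2 / c₁.1 (Fin.last B)) : (Fin (B + 1) → ℚ) × ℚ))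
    (fun _ => Sum.inr (((Fin.snoc (fun i : Fin B => -c₂.1 (Fin.castSucc i) / c₂.1 (Fin.last B)) (1 / c₂.1 (Fin.last B)) : Fin (B + 1) → ℚ), -c₂.2 / c₂.1 (Fin.last B)) : (Fin (B + 1) → ℚ) × ℚ)) hbd hdom hint (fun _ => one_ne_zero) (fun i j hij => by
      rcases hij with h | h <;> cases h)
  suffices hs₁ : ∃ c ∈ AddSubgroup.closure (GGset B 2 1), KZ.of s₁ - c ∈ KZ.relations by
    obtain ⟨c₀, hc₀, hc₀'⟩ := hs₁
    exact ⟨c₀, hc₀, by have := add_mem hrel₁ hc₀'; rwa [sub_add_sub_cancel] at this⟩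
  have hd₁ : s₁.domain = gDom B 1 m'' M' (fun _ => Sum.inr (pullC 1 α δ (((Fin.snoc (fun i : Fin B => -c₁.1 (Fin.castSucc i) / c₁.1 (Fin.last B)) (1 / c₁.1 (Fin.last B)) : Fin (B + 1) → ℚ), -c₁.2 / c₁.1 (Fin.last B)) : (Fin (B + 1) → ℚ) × ℚ)))
      (fun _ => Sum.inr (pullC 1 α δ (((Fin.snoc (fun i : Fin B => -c₂.1 (Fin.castSucc i) / c₂.1 (Fin.last B)) (1 / c₂.1 (Fin.last B)) : Fin (B + 1) → ℚ), -c₂.2 / c₂.1 (Fin.last B)) : (Fin (B + 1) → ℚ) × ℚ))) := by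
    rw [hdom₁]
    congr 1
  have hi₁ : EqOn s₁.integrand (glit B 1 (MvPolynomial.C (pullQ (fun _ : Fin 1 => (1 : ℚ))
      (fun _ => some (((Fin.snoc (ℓ₂).1 0 : Fin (B + 1) → ℚ), (ℓ₂).2) : (Fin (B + 1) → ℚ) × ℚ))) * p) L e ℓ₁ 0 0 1 (fun _ => some 0)) s₁.domain := by
    convert hint₁ using 2
    funext i
    simp only [pullA, Option.map_some]
    rw [hα, hδ, pullC_self]
  have hsem : ∀ (c : (Fin (B + 1) → ℚ) × ℚ) (w : Fin (B + 1 + 1) → ℝ),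
      affF B 1 (pullC 1 α δ c) w = affF B 1 c w - affB B 1 ℓ₂ w := fun c w => by
    rw [affF_pullC_one, hα0, hδ0]
    push_cast
    ring
  have hlast : ∀ c : (Fin (B + 1) → ℚ) × ℚ, (pullC 1 α δ (((Fin.snoc (fun i : Fin B => -c.1 (Fin.castSucc i) / c.1 (Fin.last B)) (1 / c.1 (Fin.last B)) : Fin (B + 1) → ℚ), -c.2 / c.1 (Fin.last B)) : (Fin (B + 1) → ℚ) × ℚ)).1 (Fin.last B) = 1 / c.1 (Fin.last B) :=
    fun c => by rw [pullC_fst_last, hα0, sub_zero, div_one]; simp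
  have ha : (pullC 1 α δ (((Fin.snoc (fun i : Fin B => -c₁.1 (Fin.castSucc i) / c₁.1 (Fin.last B)) (1 / c₁.1 (Fin.last B)) : Fin (B + 1) → ℚ), -c₁.2 / c₁.1 (Fin.last B)) : (Fin (B + 1) → ℚ) × ℚ)).1 (Fin.last B) ≠ 0 := by rw [hlast]; exact one_div_ne_zero hc₁
  have hb : (pullC 1 α δ (((Fin.snoc (fun i : Fin B => -c₂.1 (Fin.castSucc i) / c₂.1 (Fin.last B)) (1 / c₂.1 (Fin.last B)) : Fin (B + 1) → ℚ), -c₂.2 / c₂.1 (Fin.last B)) : (Fin (B + 1) → ℚ) × ℚ)).1 (Fin.last B) ≠ 0 := by rw [hlast]; exact one_div_ne_zero hc₂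
  have hab : (pullC 1 α δ (((Fin.snoc (fun i : Fin B => -c₁.1 (Fin.castSucc i) / c₁.1 (Fin.last B)) (1 / c₁.1 (Fin.last B)) : Fin (B + 1) → ℚ), -c₁.2 / c₁.1 (Fin.last B)) : (Fin (B + 1) → ℚ) × ℚ)).1 (Fin.last B) ≠ (pullC 1 α δ (((Fin.snoc (fun i : Fin B => -c₂.1 (Fin.castSucc i) / c₂.1 (Fin.last B)) (1 / c₂.1 (Fin.last B)) : Fin (B + 1) → ℚ), -c₂.2 / c₂.1 (Fin.last B)) : (Fin (B + 1) → ℚ) × ℚ)).1 (Fin.last B) := by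
    rw [hlast, hlast]
    intro h
    exact hc12 (by simpa using congrArg (fun q : ℚ => q⁻¹) h)
  have hZ₁ : ∀ w ∈ s₁.domain, |affB B 1 κ₀ w| <
      |affB B 1 ((restr B v - restr B u) + (v.1 (Fin.last B) - u.1 (Fin.last B)) • ℓ₂) w| := fun w hw => by
    have h := hZ _ ((hΨ₁ w).1 hw)
    rwa [affB_pullInv, affB_pullInv] at h
  have hkey : ∀ z : Fin (B + 1 + 1) → ℝ, |affB B 1 κ₀ z| ≤
      |affB B 1 ((restr B v - restr B u) + (v.1 (Fin.last B) - u.1 (Fin.last B)) • ℓ₂) z| →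
      affF B 1 (pullC 1 α δ (((Fin.snoc (fun i : Fin B => -c₁.1 (Fin.castSucc i) / c₁.1 (Fin.last B)) (1 / c₁.1 (Fin.last B)) : Fin (B + 1) → ℚ), -c₁.2 / c₁.1 (Fin.last B)) : (Fin (B + 1) → ℚ) × ℚ)) z = 0 → affF B 1 (pullC 1 α δ (((Fin.snoc (fun i : Fin B => -c₂.1 (Fin.castSucc i) / c₂.1 (Fin.last B)) (1 / c₂.1 (Fin.last B)) : Fin (B + 1) → ℚ), -c₂.2 / c₂.1 (Fin.last B)) : (Fin (B + 1) → ℚ) × ℚ)) z = 0 →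
      z (Fin.castAdd 1 (Fin.last B)) = 0 := fun z hreg h1 h2 => by
    rw [hsem, sub_eq_zero] at h1 h2
    rcases hc with ⟨h1c, h2c⟩ | ⟨h1c, h2c⟩
    · rw [h1c] at h1
      rw [h2c] at h2
      exact yval_eq_zero_of_corner u v κ₀ ℓ₂ A' hu hv huℓ z hreg h1 h2
    · rw [h1c] at h1
      rw [h2c] at h2
      exact yval_eq_zero_of_corner u v κ₀ ℓ₂ A' hu hv huℓ z hreg h2 h1
  exact good_shearedPiece L e ℓ₁ s₁ M' _ _ _ κ₀ _ hbd₁ hd₁ hi₁ ha hb hab hZ₁ hkey Hpar Hdthick Hdfar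

/-- **A band through the coordinate swap `y ↔ t`.** See the module docstring. -/
theorem good_swapBand (s : KZ.IntegralRep (B + 1 + 1)) (M : Fin m' → (Fin (B + 1) → ℚ) × ℚ)
    (p : MvPolynomial (Fin B) ℚ) (u v : (Fin (B + 1) → ℚ) × ℚ) (κ₀ : (Fin B → ℚ) × ℚ) (A' : ℚ)
    (hbd : Bornology.IsBounded s.domain)
    (hdom : s.domain = gDom B 1 m' M (fun _ => Sum.inr u) (fun _ => Sum.inr v))
    (hint : EqOn s.integrand (glit B 1 p L e ℓ₁ ℓ₂ 0 1 (fun _ => some 0)) s.domain)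
    (hu : u.1 (Fin.last B) ≠ 0) (hv : v.1 (Fin.last B) ≠ 0) (hne : u.1 (Fin.last B) ≠ v.1 (Fin.last B))
    (hsame : 0 < u.1 (Fin.last B) ↔ 0 < v.1 (Fin.last B))
    (huℓ : restr B u + u.1 (Fin.last B) • ℓ₂ =
      κ₀ + A' • ((restr B v - restr B u) + (v.1 (Fin.last B) - u.1 (Fin.last B)) • ℓ₂))
    (hZ : ∀ w ∈ s.domain, |affB B 1 κ₀ w| <
      |affB B 1 ((restr B v - restr B u) + (v.1 (Fin.last B) - u.1 (Fin.last B)) • ℓ₂) w|)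
    (Hpar : ∀ (m' : ℕ) (s : KZ.IntegralRep (B + 1 + 1)) (M : Fin m' → (Fin (B + 1) → ℚ) × ℚ)
      (p : MvPolynomial (Fin B) ℚ) (u v : (Fin (B + 1) → ℚ) × ℚ), Bornology.IsBounded s.domain →
      s.domain = gDom B 1 m' M (fun _ => Sum.inr u) (fun _ => Sum.inr v) →
      EqOn s.integrand (glit B 1 p L e ℓ₁ 0 0 1 (fun _ => some 0)) s.domain →
      u.1 (Fin.last B) ≠ 0 → u.1 (Fin.last B) = v.1 (Fin.last B) →
      (∀ z : Fin (B + 1 + 1) → ℝ, (∀ j, 0 < affF B 1 (M j) z) → 0 < affF B 1 u z ∧ affF B 1 u z < affF B 1 v z) →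
      ∃ c ∈ AddSubgroup.closure (GGset B 2 1), KZ.of s - c ∈ KZ.relations)
    (Hdthick : ∀ (m' : ℕ) (s : KZ.IntegralRep (B + 1 + 1)) (M : Fin m' → (Fin (B + 1) → ℚ) × ℚ)
      (p : MvPolynomial (Fin B) ℚ) (u v κ : (Fin (B + 1) → ℚ) × ℚ) (A : ℚ), Bornology.IsBounded s.domain →
      s.domain = gDom B 1 m' M (fun _ => Sum.inr u) (fun _ => Sum.inr v) →
      EqOn s.integrand (glit B 1 p L e ℓ₁ 0 0 1 (fun _ => some 0)) s.domain →
      κ.1 (Fin.last B) = 0 → u - κ = A • (v - u) → 0 < A →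
      (∀ z : Fin (B + 1 + 1) → ℝ, (∀ j, 0 < affF B 1 (M j) z) →
        affF B 1 κ z < 0 ∧ 0 < affF B 1 u z ∧ affF B 1 u z < affF B 1 v z) →
      (∃ z ∈ closure {z : Fin (B + 1 + 1) → ℝ | ∀ j, 0 < affF B 1 (M j) z},
        affF B 1 κ z = 0 ∧ affF B 1 u z = 0 ∧ affF B 1 v z = 0 ∧
        z (Fin.castAdd 1 (Fin.last B)) = affB B 1 (0 : (Fin B → ℚ) × ℚ) z) →
      ∃ c ∈ AddSubgroup.closure (GGset B 2 1), KZ.of s - c ∈ KZ.relations)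
    (Hdfar : ∀ (m' : ℕ) (s : KZ.IntegralRep (B + 1 + 1)) (M : Fin m' → (Fin (B + 1) → ℚ) × ℚ)
      (p : MvPolynomial (Fin B) ℚ) (u v κ : (Fin (B + 1) → ℚ) × ℚ) (A : ℚ), Bornology.IsBounded s.domain →
      s.domain = gDom B 1 m' M (fun _ => Sum.inr u) (fun _ => Sum.inr v) →
      EqOn s.integrand (glit B 1 p L e ℓ₁ 0 0 1 (fun _ => some 0)) s.domain →
      κ.1 (Fin.last B) = 0 → u - κ = A • (v - u) → 0 < A →
      (∀ z : Fin (B + 1 + 1) → ℝ, (∀ j, 0 < affF B 1 (M j) z) →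
        0 < affF B 1 κ z ∧ affF B 1 u z < affF B 1 v z ∧ 2 * affF B 1 κ z ≤ affF B 1 v z) →
      (∃ z ∈ closure {z : Fin (B + 1 + 1) → ℝ | ∀ j, 0 < affF B 1 (M j) z},
        affF B 1 κ z = 0 ∧ affF B 1 u z = 0 ∧ affF B 1 v z = 0 ∧
        z (Fin.castAdd 1 (Fin.last B)) = affB B 1 (0 : (Fin B → ℚ) × ℚ) z) →
      ∃ c ∈ AddSubgroup.closure (GGset B 2 1), KZ.of s - c ∈ KZ.relations) :
    ∃ c ∈ AddSubgroup.closure (GGset B 2 1), KZ.of s - c ∈ KZ.relations := by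
  obtain ⟨C, s', hlu, hplayers, hdomC, hΨ, hbd', hint', hrel⟩ :=
    swapBandYT L e ℓ₁ ℓ₂ s M p u v hbd hdom hint hu hv hsame
  suffices hs' : ∃ c ∈ AddSubgroup.closure (GGset B 2 1), KZ.of s' - c ∈ KZ.relations by
    obtain ⟨c₀, hc₀, hc₀'⟩ := hs'
    exact ⟨c₀, hc₀, by have := add_mem hrel hc₀'; rwa [sub_add_sub_cancel] at this⟩
  have hZ' : ∀ w ∈ s'.domain, |affB B 1 κ₀ w| <
      |affB B 1 ((restr B v - restr B u) + (v.1 (Fin.last B) - u.1 (Fin.last B)) • ℓ₂) w| := fun w hw => by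
    have h := hZ _ ((hΨ w).1 hw)
    rwa [affB_swapYT, affB_swapYT] at h
  refine orderCells_good (GGset B 2 1) s' C L e p ℓ₁ 0 (fun _ => some (((Fin.snoc (ℓ₂).1 0 : Fin (B + 1) → ℚ), (ℓ₂).2) : (Fin (B + 1) → ℚ) × ℚ)) hbd' hlu hdomC hint'
    fun m'' s₀ M' lo hi hsub hbd₀ hdom₀ hint₀ hprov => ?_
  -- a mutual bound of the single fibre empties the domain
  rcases hlo : lo 0 with j | θ₁
  · refine good_of_null s₀ ?_
    have he : s₀.domain = ∅ := by
      rw [hdom₀]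
      exact Set.eq_empty_iff_forall_notMem.2 fun z hz => by
        have h := (hz.2 0).1
        rw [hlo, Subsingleton.elim j 0] at h
        exact lt_irrefl _ h
    rw [he, measure_empty]
  rcases hhi : hi 0 with j | θ₂
  · refine good_of_null s₀ ?_
    have he : s₀.domain = ∅ := by
      rw [hdom₀]
      exact Set.eq_empty_iff_forall_notMem.2 fun z hz => by
        have h := (hz.2 0).2
        rw [hhi, Subsingleton.elim j 0] at h
        exact lt_irrefl _ h
    rw [he, measure_empty]
  have hlo' : lo = fun _ => Sum.inr θ₁ := funext fun i => by rw [Subsingleton.elim i 0, hlo]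
  have hhi' : hi = fun _ => Sum.inr θ₂ := funext fun i => by rw [Subsingleton.elim i 0, hhi]
  obtain ⟨q₁, hq₁, hq₁'⟩ := hprov 0 θ₁ (Or.inl hlo)
  obtain ⟨q₂, hq₂, hq₂'⟩ := hprov 0 θ₂ (Or.inr hhi)
  have hθ₁ := hplayers q₁ hq₁ θ₁ hq₁'
  have hθ₂ := hplayers q₂ hq₂ θ₂ hq₂'
  rw [hlo', hhi'] at hdom₀
  have hZ₀ : ∀ w ∈ s₀.domain, |affB B 1 κ₀ w| <
      |affB B 1 ((restr B v - restr B u) + (v.1 (Fin.last B) - u.1 (Fin.last B)) • ℓ₂) w| :=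
    fun w hw => hZ' w (hsub hw)
  -- a `Y`-free bound: product case
  have hprod : θ₁.1 (Fin.last B) = 0 ∨ θ₂.1 (Fin.last B) = 0 →
      ∃ c ∈ AddSubgroup.closure (GGset B 2 1), KZ.of s₀ - c ∈ KZ.relations := fun h =>
    good_product (fun _ => some (((Fin.snoc (ℓ₂).1 0 : Fin (B + 1) → ℚ), (ℓ₂).2) : (Fin (B + 1) → ℚ) × ℚ)) (fun _ => θ₁) (fun _ => θ₂) s₀ M' L e p ℓ₁ 0
      (fun _ => Sum.inr θ₁) (fun _ => Sum.inr θ₂) (Or.inl rfl) hbd₀ hdom₀ hint₀ (fun _ => rfl)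
      (fun _ => rfl) fun _ c hc => by
        simp only [Option.some.injEq] at hc
        subst hc
        simpa using h
  rcases hθ₁ with h0 | hθ₁
  · exact hprod (Or.inl h0)
  rcases hθ₂ with h0 | hθ₂
  · exact hprod (Or.inr h0)
  -- two equal transverse bounds: empty fibres
  have hempty : θ₁ = θ₂ → ∃ c ∈ AddSubgroup.closure (GGset B 2 1), KZ.of s₀ - c ∈ KZ.relations :=
    fun h => by
      subst h
      refine good_of_null s₀ ?_
      have he : s₀.domain = ∅ := by
        rw [hdom₀]
        exact Set.eq_empty_iff_forall_notMem.2 fun z hz => by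
          rw [mem_gDom_one] at hz
          exact lt_irrefl _ (hz.2.1.trans hz.2.2)
      rw [he, measure_empty]
  -- two transverse bounds
  have hpiece : ∀ c₁ c₂ : (Fin (B + 1) → ℚ) × ℚ, θ₁ = (((Fin.snoc (fun i : Fin B => -c₁.1 (Fin.castSucc i) / c₁.1 (Fin.last B)) (1 / c₁.1 (Fin.last B)) : Fin (B + 1) → ℚ), -c₁.2 / c₁.1 (Fin.last B)) : (Fin (B + 1) → ℚ) × ℚ) → θ₂ = (((Fin.snoc (fun i : Fin B => -c₂.1 (Fin.castSucc i) / c₂.1 (Fin.last B)) (1 / c₂.1 (Fin.last B)) : Fin (B + 1) → ℚ), -c₂.2 / c₂.1 (Fin.last B)) : (Fin (B + 1) → ℚ) × ℚ) →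
      ((c₁ = u ∧ c₂ = v) ∨ (c₁ = v ∧ c₂ = u)) →
      ∃ c ∈ AddSubgroup.closure (GGset B 2 1), KZ.of s₀ - c ∈ KZ.relations :=
    fun c₁ c₂ h1 h2 hc => by
      subst h1 h2
      exact good_swapPiece L e ℓ₁ ℓ₂ s₀ M' p u v c₁ c₂ κ₀ A' hbd₀ hdom₀ hint₀ hc hu hv hne huℓ hZ₀
        Hpar Hdthick Hdfar
  rcases hθ₁ with h₁ | h₁ <;> rcases hθ₂ with h₂ | h₂
  · exact hempty (h₁.trans h₂.symm)
  · exact hpiece u v h₁ h₂ (Or.inl ⟨rfl, rfl⟩)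
  · exact hpiece v u h₁ h₂ (Or.inr ⟨rfl, rfl⟩)
  · exact hempty (h₁.trans h₂.symm)

end SwapBand

end RebasePos

/-- **Registered part of `stub_rebaseSimplePosOne` (line `janus-bands`, v6.2): the key
computation at a corner of a swapped transverse cell** (`RebasePos.yval_eq_zero_of_corner`, the
double-corner test behind `RebasePos.good_swapBand`, the main result of this file): if both
transverse players `(Y − u(x', 0))/u_y`, `(Y − v(x', 0))/v_y` take the value `ℓ₂(x')` at `z`, the
`x'`-forms `κ₀`, `φℓ = (v − u)(x', ℓ₂)` satisfy `|κ₀| ≤ |φℓ|` at `z` and `u(x', ℓ₂) = κ₀ + A' φℓ`,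
then the coordinate `Y` of `z` vanishes. -/
theorem rebaseSimplePos_yvalEqZeroOfCorner (B : ℕ) (u v : (Fin (B + 1) → ℚ) × ℚ) (κ₀ ℓ₂ : (Fin B → ℚ) × ℚ) (A' : ℚ) (hu : u.1 (Fin.last B) ≠ 0) (hv : v.1 (Fin.last B) ≠ 0) (huℓ : SeparatePos.restr B u + u.1 (Fin.last B) • ℓ₂ = κ₀ + A' • ((SeparatePos.restr B v - SeparatePos.restr B u) + (v.1 (Fin.last B) - u.1 (Fin.last B)) • ℓ₂)) (z : Fin (B + 1 + 1) → ℝ) (hreg : |SeparatePos.affB B 1 κ₀ z| ≤ |SeparatePos.affB B 1 ((SeparatePos.restr B v - SeparatePos.restr B u) + (v.1 (Fin.last B) - u.1 (Fin.last B)) • ℓ₂) z|) (h1 : SeparatePos.affF B 1 (((Fin.snoc (fun i : Fin B => -u.1 (Fin.castSucc i) / u.1 (Fin.last B)) (1 / u.1 (Fin.last B)) : Fin (B + 1) → ℚ), -u.2 / u.1 (Fin.last B)) : (Fin (B + 1) → ℚ) × ℚ) z = SeparatePos.affB B 1 ℓ₂ z) (h2 : SeparatePos.affF B 1 (((Fin.snoc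 (fun i : Fin B => -v.1 (Fin.castSucc i) / v.1 (Fin.last B)) (1 / v.1 (Fin.last B)) : Fin (B + 1) → ℚ), -v.2 / v.1 (Fin.last B)) : (Fin (B + 1) → ℚ) × ℚ) z = SeparatePos.affB B 1 ℓ₂ z) : z (Fin.castAdd 1 (Fin.last B)) = 0 :=
  RebasePos.yval_eq_zero_of_corner u v κ₀ ℓ₂ A' hu hv huℓ z hreg h1 h2

end Summit.KontsevichZagierPeriods.ArrangementNormalForm.JanusBands
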